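import Summits.AtomisticToContinuum.FouriersLaw.Theorems.BondHeatUncertaintySubdiffusiveBondHeatOfDeficitCesaroEW

/-!
# The Ohmic floor is necessary for the stub, given a nonnegative transient (the other half of the decomposition)

Crux `stmt-AtomisticToContinuum-9120` (`BondHeatUncertainty.SubdiffusiveBondHeat`, (S)), line `bath-bond-deficit-integral`.
Notation (VERBATIM the `let K / θ / E` of route `BoundaryEscapeDeficit`): `K_N`, `θ_N(s) = (γ/T²)∫₀ˢ K_N`,
`E_N = 1 − (γ/T²)∫_{(0,∞)} K_N`, `W_N(t) = ∫₀ᵗ(1 − θ_N)`.  The registered open stub `stub_deficitCesaroEW` is the Cesàro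
EW law `W_N(t) ≤ C√t` on `[1, cN²]`, `N ≥ N₀`; the companion file `…EscapeDeficitNonneg.lean` proves `E_N ≥ 0` and hence
that the EW TRANSIENT law is necessary for the stub.  Here, the OHMIC FLOOR:

* `ohmicFloor_of_deficitCesaroEW_of_nonnegTransient` — IF the once-integrated transient is nonnegative,
  `0 ≤ ∫₀ᵗ (1 − θ_N(s) − E_N) ds` for all `t ≥ 0` and all large `N` (physically: the boundary deficit relaxes to its floor
  `E_N` from ABOVE — true at the harmonic member, where `K_N ≥ 0`; conjectural in general, cf. `GriffithsLimitExchange.BoundaryDEP`),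
  THEN the stub implies the Ohmic floor `E_N ≤ (C/√c)/N` for all large `N` — verbatim the floor hypothesis of the landed glue
  `subdiffusiveBondHeat_of_ohmicFloor_transientEW` (and of `stub_ohmicFloor_of_escapeLaw`), i.e. bounded response seen from
  the contact.  Proof: at `t = cN² ≥ 1`, `cN²·E_N ≤ ∫₀ᵗ(transient) + tE_N = W_N(t) ≤ C√c·N`.

So, on the real objects and kernel-checked: `OhmicFloor ∧ TransientEW ⟹ stub` (p138777), `stub ⟹ TransientEW` (EscapeDeficitNonneg),
`stub ∧ (transient ≥ 0) ⟹ OhmicFloor` (this file) — the crux-strategist's (D1) `(S)|_{b=0} ≡ Ohm ⊕ EW-transient`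
(`Cruxes/SubdiffusiveBondHeat/STRATEGY-CENSUS.md` §Decomposition; `Disproof.lean` §4 `ohmicFloor_necessary_at_bathBond` is the
abstract prototype of this file).  Nothing here closes the item.
-/

noncomputable section

open MeasureTheory Set Filter Topology intervalIntegral

namespace Summit.AtomisticToContinuum.FouriersLaw.Theorems.SubdiffusiveBondHeat

open Literature.MathematicalPhysics.KineticTheory.HeatConduction

/-- **Stub ∧ nonnegative transient ⟹ Ohmic floor.**  Hypotheses: (stub) `∫₀ᵗ(1 − θ_N) ≤ C√t` for `1 ≤ t ≤ cN²`, `N ≥ N₀`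
(= `stub_deficitCesaroEW`); (sign) `0 ≤ ∫₀ᵗ(1 − θ_N − E_N)` for all `t ≥ 0`, `N ≥ N₁`.  Conclusion: `E_N ≤ C₁/N` for
`N ≥ N₀'` with `C₁ = max C 0/√c` — verbatim the floor hypothesis of `subdiffusiveBondHeat_of_ohmicFloor_transientEW`.
Proof: for `N ≥ max(N₀, N₁, ⌈1/√c⌉₊ + 1)` the Thouless time `t = cN²` is `≥ 1`, and
`cN²·E_N = W_N(t) − ∫₀ᵗ(transient) ≤ W_N(t) ≤ C√c·N`. [folklore] -/
theorem ohmicFloor_of_deficitCesaroEW_of_nonnegTransient :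
    (∀ ω₂ lam β γ : ℝ, 0 < ω₂ → 0 < lam → 0 < β → 0 < γ → ∀ T : ℝ, 0 < T →
      ∃ C c : ℝ, 0 < c ∧ ∃ N₀ : ℕ, ∀ N : ℕ, N₀ ≤ N → ∀ t : ℝ, 1 ≤ t → t ≤ c * (N : ℝ) ^ 2 →
        (∫ s in (0 : ℝ)..t,
          (1 - γ / T ^ 2 * (∫ u in (0 : ℝ)..s,
            if h : 0 < N then
              ∫ z, ((z.2 ⟨0, h⟩) ^ 2 - T) *
                  (∫ y, ((y.2 ⟨0, h⟩) ^ 2 - T)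
                    ∂((pinnedChain ω₂ lam β γ).transitionKernel N T T u.toNNReal z))
                ∂((pinnedChain ω₂ lam β γ).gibbsMeasure N T)
            else 0))) ≤ C * Real.sqrt t) →
    (∀ ω₂ lam β γ : ℝ, 0 < ω₂ → 0 < lam → 0 < β → 0 < γ → ∀ T : ℝ, 0 < T →
      ∃ N₁ : ℕ, ∀ N : ℕ, N₁ ≤ N → ∀ t : ℝ, 0 ≤ t →
        0 ≤ ∫ s in (0 : ℝ)..t,
          (1 - γ / T ^ 2 * (∫ u in (0 : ℝ)..s,
              if h : 0 < N then
                ∫ z, ((z.2 ⟨0, h⟩) ^ 2 - T) *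
                    (∫ y, ((y.2 ⟨0, h⟩) ^ 2 - T)
                      ∂((pinnedChain ω₂ lam β γ).transitionKernel N T T u.toNNReal z))
                  ∂((pinnedChain ω₂ lam β γ).gibbsMeasure N T)
              else 0) -
            (1 - γ / T ^ 2 * (∫ u in Set.Ioi (0 : ℝ),
              if h : 0 < N then
                ∫ z, ((z.2 ⟨0, h⟩) ^ 2 - T) *
                    (∫ y, ((y.2 ⟨0, h⟩) ^ 2 - T)
                      ∂((pinnedChain ω₂ lam β γ).transitionKernel N T T u.toNNReal z))
                  ∂((pinnedChain ω₂ lam β γ).gibbsMeasure N T)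
              else 0)))) →
    (∀ ω₂ lam β γ : ℝ, 0 < ω₂ → 0 < lam → 0 < β → 0 < γ → ∀ T : ℝ, 0 < T →
      ∃ C₁ : ℝ, ∃ N₀ : ℕ, ∀ N : ℕ, N₀ ≤ N →
        1 - γ / T ^ 2 * (∫ u in Set.Ioi (0 : ℝ),
          if h : 0 < N then
            ∫ z, ((z.2 ⟨0, h⟩) ^ 2 - T) *
                (∫ y, ((y.2 ⟨0, h⟩) ^ 2 - T) ∂((pinnedChain ω₂ lam β γ).transitionKernel N T T u.toNNReal z))
              ∂((pinnedChain ω₂ lam β γ).gibbsMeasure N T)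
          else 0) ≤ C₁ / (N : ℝ)) := by
  intro hstub hsign ω₂ lam β γ hω hl hβ hγ T hT
  obtain ⟨C, c, hc, N₀, hC⟩ := hstub ω₂ lam β γ hω hl hβ hγ T hT
  obtain ⟨N₁, hS⟩ := hsign ω₂ lam β γ hω hl hβ hγ T hT
  -- threshold making the Thouless time `cN² ≥ 1`
  set N₂ : ℕ := ⌈1 / Real.sqrt c⌉₊ + 1 with hN₂
  refine ⟨max C 0 / Real.sqrt c, max (max N₀ N₁) N₂, fun N hN => ?_⟩
  have hN₀ : N₀ ≤ N := le_trans ((le_max_left _ _).trans (le_max_left _ _)) hN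
  have hN₁ : N₁ ≤ N := le_trans ((le_max_right _ _).trans (le_max_left _ _)) hN
  have hNN₂ : N₂ ≤ N := le_trans (le_max_right _ _) hN
  have hsc : 0 < Real.sqrt c := Real.sqrt_pos.2 hc
  have hN2r : (1 : ℝ) / Real.sqrt c < (N : ℝ) := by
    have h1 : (1 : ℝ) / Real.sqrt c ≤ ⌈1 / Real.sqrt c⌉₊ := Nat.le_ceil _
    have h2 : ((⌈1 / Real.sqrt c⌉₊ : ℕ) : ℝ) + 1 ≤ (N : ℝ) := by
      have : ((N₂ : ℕ) : ℝ) ≤ (N : ℝ) := by exact_mod_cast hNN₂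
      simpa [hN₂] using this
    linarith
  have hNpos : (0 : ℝ) < N := lt_trans (by positivity) hN2r
  have hN0 : 0 < N := by exact_mod_cast hNpos
  -- the Thouless time
  set t : ℝ := c * (N : ℝ) ^ 2 with ht
  have hsqrtN : 1 < Real.sqrt c * (N : ℝ) := by
    rw [div_lt_iff₀ hsc] at hN2r
    linarith
  have ht1 : 1 ≤ t := by
    have : (Real.sqrt c * (N : ℝ)) ^ 2 = t := by
      rw [ht, mul_pow, Real.sq_sqrt hc.le]
    nlinarith
  have ht0 : 0 ≤ t := le_trans zero_le_one ht1
  have hsqrt_t : Real.sqrt t = Real.sqrt c * (N : ℝ) := by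
    rw [ht, Real.sqrt_mul hc.le, Real.sqrt_sq hNpos.le]
  -- the objects at this `N`, despelled
  have hW := hC N hN₀ t ht1 le_rfl
  have hTr := hS N hN₁ t ht0
  simp only [dif_pos hN0] at hW hTr ⊢
  set K : ℝ → ℝ := fun u => ∫ z, ((z.2 ⟨0, hN0⟩) ^ 2 - T) *
      (∫ y, ((y.2 ⟨0, hN0⟩) ^ 2 - T) ∂((pinnedChain ω₂ lam β γ).transitionKernel N T T u.toNNReal z))
    ∂((pinnedChain ω₂ lam β γ).gibbsMeasure N T) with hK
  set E : ℝ := 1 - γ / T ^ 2 * ∫ u in Set.Ioi (0 : ℝ), K u with hE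
  set g : ℝ → ℝ := fun s => 1 - γ / T ^ 2 * ∫ u in (0 : ℝ)..s, K u with hg
  have hgc : Continuous g := continuous_const.sub (pinnedChain_continuous_stepResponse hω hl hβ hγ hT hN0)
  have hgi : IntervalIntegrable g volume 0 t := hgc.intervalIntegrable 0 t
  -- `W(t) = ∫ (g - E) + t E`
  have hsplit : ∫ s in (0 : ℝ)..t, g s = (∫ s in (0 : ℝ)..t, (g s - E)) + t * E := by
    rw [intervalIntegral.integral_sub hgi intervalIntegrable_const, intervalIntegral.integral_const, sub_zero,
      smul_eq_mul]
    ring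
  have hW' : ∫ s in (0 : ℝ)..t, g s ≤ C * Real.sqrt t := by simpa only [hg, hK] using hW
  have hTr' : 0 ≤ ∫ s in (0 : ℝ)..t, (g s - E) := by simpa only [hg, hK, hE] using hTr
  -- `t E ≤ C √t ≤ max C 0 · √c · N`
  have htE : t * E ≤ max C 0 * (Real.sqrt c * (N : ℝ)) := by
    have h1 : t * E ≤ C * Real.sqrt t := by linarith
    rw [hsqrt_t] at h1
    exact h1.trans (mul_le_mul_of_nonneg_right (le_max_left _ _) (by positivity))
  -- divide by `t = cN²`
  have hgoal : E ≤ max C 0 / Real.sqrt c / (N : ℝ) := by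
    rw [le_div_iff₀ hNpos, le_div_iff₀ hsc]
    have hcs : Real.sqrt c * Real.sqrt c = c := Real.mul_self_sqrt hc.le
    have : t * E = E * (N : ℝ) * Real.sqrt c * (Real.sqrt c * (N : ℝ)) := by
      rw [ht]
      linear_combination (-(E * (N : ℝ) ^ 2)) * hcs
    rw [this] at htE
    have hpos : 0 < Real.sqrt c * (N : ℝ) := by positivity
    exact le_of_mul_le_mul_right htE hpos
  simpa only [hE, hK] using hgoal

end Summit.AtomisticToContinuum.FouriersLaw.Theorems.SubdiffusiveBondHeat

end
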